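/-
Copyright (c) 2026 the pub-hodgecm-mathlib formalisation cell (harness21).  Prover seat hodgecm-mathlib-K2E3-p26 (g0), Track B «K2-LIT» ∕ h413
(`stmt-HodgeConjecture-24833`), line `K2_E3_EllipticInputs`, unit U4 «Keys», cell «U4-RAM» (dealer K2E3-plan (g4) L4∕E3 EMIT #5), PART «U4Keys» socket :155
`sig_K2E3KeysThmTwoContractingRamifiedCharOneDepthZeroNormTrivial` (depth 0, Branch B), plan step Z3 (the Casselman pair), THE TWO CONSTANT ENTRIES.  2026-09-04.
-/
import Summits.HodgeConjecture.HodgeConjecture.Theorems.K2E3BranchBCellFunctionsCM      -- ★ Z3-a FILE 2 p861630 (this seat): regions, factorisations and cell values in the (G3) frame; brings ★ FILE 1, ★ Z2A-3b∕c, ★ Z2, ★ Z2-gen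
import HarnessLib

/-!
# K2 ∕ E3 «EllipticInputs», unit U4 «Keys» — socket :155 (depth 0, Branch B), step Z3: THE TWO CONSTANT ENTRIES OF THE CASSELMAN PAIR —
# `Λ_1(f_w) = μ(N₀)` and `Λ_{w₀}(f₁) = μ{n ∈ N : w₀ n w₀ ∈ I}`, as Bochner integrals over `N(L⁺_v)`, with their integrands identified as INDICATORS (hence integrable)

Cell hodgecm-mathlib (D-0151), FLOOR 0, Track B «K2-LIT», engine E3, crux item H413 = stmt-HodgeConjecture-24833 (route `HCCMUnconditional`, no route verbs); target BY NAME the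
OPEN socket `…U4Keys.sig_K2E3KeysThmTwoContractingRamifiedCharOneDepthZeroNormTrivial` (:155; BRANCH B of design D-I v2 of K2E3-p06 (g4)), `PAPER-Z3-DepthZeroInert` §1 entries
`Λ_1(f_w) = vol(N₀)`, `Λ_{w₀}(f₁) = vol N(𝔭)`.  Author K2E3-p26 (g0) (cell «U4-RAM», co-hand K2E3-p32 (g0)).  `--supports stmt-HodgeConjecture-24833 --as helper`; THEOREMS ONLY
(no `def`, no `instance`, no notation, no named-fact hypothesis, no `sorry`).  NOT THE PAYER.

THE FRAME is ★ Z3-a FILE 2's (= ★ `K2E3BranchALettersCM`'s) VERBATIM, plus an ARBITRARY measure `μ` on `↥t.N` and the letters of the normalised `(I, θ)`-type basis of ★ p861529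
`K2E3IwahoriTypeBasisMackey` (K2E3-p32 (g0)): `heig_w ∕ hw1 : f_w(1) = 0 ∕ hwg : f_w(w₀) = 1` and `heig₁ ∕ h11 : f₁(1) = 1 ∕ h1g : f₁(w₀) = 0`, and the depth-zero letter
`hθ : θ = 1 on I ∩ N` resp. `on I ∩ N̄` (★ Z2A-3b `theta_eq_one_of_mem_map` ∕ `chi_unit_apply_zero_zero_mul` give it for `θ(g) = χ₁(g₀₀)`).
* §1 **`toFun_weyl_mul_eq_indicator`** — `n ↦ f_w(w₀ n)` IS the indicator of `N₀ = {n ∈ N : n ∈ I}` (on `N₀`: `θ(n)·f_w(w₀) = 1`, ★ FILE 2 §5; off `N₀`: `w₀n = pκ ∈ P·I` by ★ FILE 2 §2 and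
  `f_w(pκ) = τ(p)θ(κ)f_w(1) = 0`); hence **`integral_toFun_weyl_mul_eq`**: `Λ_1(f_w) = ∫_N f_w(w₀ n) dμ = μ.real N₀` and **`integrable_toFun_weyl_mul`** (`μ N₀ < ∞`).
* §2 **`toFun_conj_eq_indicator`** — `n ↦ f₁(w₀ n w₀)` IS the indicator of `{n ∈ N : w₀ n w₀ ∈ I}` (`= N(𝔭)` in `PAPER-Z3`; on it `θ·f₁(1) = 1`, off it `w₀nw₀ = p w₀ n₂` by ★ FILE 2 §3 and
  `f₁(p w₀ n₂) = τ(p)θ(n₂)f₁(w₀) = 0`); hence **`integral_toFun_conj_eq`**: `Λ_{w₀}(f₁) = μ.real {n : w₀nw₀ ∈ I}` and **`integrable_toFun_conj`**.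
The RATIO `μ(N(𝔭)) = q⁻³ μ(N₀)` (Haar scaling under the torus) and the two non-constant entries `G₁ = Λ_1(f₁)`, `G₂ = Λ_{w₀}(f_w)` (shell sums) are Z3-c, not here.

HONEST LABEL: HC_CM is proved only modulo the 7 printed citations (2 remaining named inputs: hLiu418 = stmt-HodgeConjecture-24832, h413 = stmt-HodgeConjecture-24833)
until rung 0 closes; count-neutral — this file does NOT pay the socket; no printed citation is discharged.

## References
* [Casselman1980] W. Casselman, *The unramified principal series of p-adic groups I*, Compositio Math. 40 (1980), §3 (the basis of the Iwahori-fixed vectors and the intertwining operators on it).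
* [Casselman1995] W. Casselman, *Introduction to the theory of admissible representations of `p`-adic reductive groups* (1995), §6.4 (the rank-one intertwining integrals).
* [Keys1984] D. Keys, *Principal series representations of special unitary groups over local fields*, Compositio Math. 51 (1984), §7.
* [Rogawski1990] J. Rogawski, *Automorphic representations of unitary groups in three variables*, Ann. of Math. Stud. 123 (1990), §1.10 p. 9, §12.1 p. 171.
-/

set_option autoImplicit false
-- the mandated namespace has the single-problem summit's repeated segment (`HodgeConjecture.HodgeConjecture`)
set_option linter.dupNamespace false

noncomputable section

open NumberField IsDedekindDomain MeasureTheory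
open scoped Matrix MatrixGroups WithZero Valued
open Literature.NumberTheory Literature.NumberTheory.Automorphic Literature.NumberTheory.Automorphic.UnitaryGroup
open Literature.NumberTheory.Rogawski1990

namespace Summit.HodgeConjecture.HodgeConjecture.Cruxes.H413.K2E3BranchBCasselmanPairConstants

open Summit.HodgeConjecture.HodgeConjecture.Cruxes.H413 Summit.HodgeConjecture.HodgeConjecture.Cruxes.H413.K2E3BranchBCellFunctionsCM

variable (L : Type) [Field L] [NumberField L] [IsCMField L] (v : HeightOneSpectrum (𝓞 ↥(maximalRealSubfield L)))
  (w : PlacesOver L v) (hw : IsCMField.complexConj L • w.1 = w.1)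
  (eA : Gqs L v ≃ₜ* ↥(unitaryGroupOfForm (galAdicCompletionMap (L := L) (IsCMField.complexConj L) hw) ((StdForm.antidiagonal 3).over (w.1.adicCompletion L))))
  (heA : ∀ g : Gqs L v,
    ((eA g : ↥(unitaryGroupOfForm (galAdicCompletionMap (L := L) (IsCMField.complexConj L) hw) ((StdForm.antidiagonal 3).over (w.1.adicCompletion L)))) :
        GL (Fin 3) (w.1.adicCompletion L)) =
      ((localNonsplitEquiv (IsCMField.complexConj L) (qsForm L) (IsCMField.complexConj_ne_one L) w hw g :
        ↥(unitaryGroupOfForm (galAdicCompletionMap (L := L) (IsCMField.complexConj L) hw) (placeForm (qsForm L) w.1))) : GL (Fin 3) (w.1.adicCompletion L)))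
  {ϖ : w.1.adicCompletion L} (hϖ : Valued.v ϖ = WithZero.exp (-1 : ℤ))
  (g₁ : GL (Fin 3) (w.1.adicCompletion L)) (hg₁ : (g₁ : Matrix (Fin 3) (Fin 3) (w.1.adicCompletion L)) = Matrix.diagonal ![(1 : w.1.adicCompletion L), 1, ϖ])
  (K0 K1 I : Subgroup (Gqs L v))
  (hK0 : K0 = ((glInt 3 (w.1.adicCompletion L)).subgroupOf
    (unitaryGroupOfForm (galAdicCompletionMap (L := L) (IsCMField.complexConj L) hw) ((StdForm.antidiagonal 3).over (w.1.adicCompletion L)))).comap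
      eA.toMulEquiv.toMonoidHom)
  (hK1 : K1 = (((glInt 3 (w.1.adicCompletion L)).map (MulAut.conj g₁).toMonoidHom).subgroupOf
    (unitaryGroupOfForm (galAdicCompletionMap (L := L) (IsCMField.complexConj L) hw) ((StdForm.antidiagonal 3).over (w.1.adicCompletion L)))).comap
      eA.toMulEquiv.toMonoidHom)
  (hI : I = K0 ⊓ K1)
  (t : ParabolicTriple (Gqs L v)) (ht : t = cmBorelTriple L 3 v)
  (w₀ : Gqs L v) (hw₀ : Units.val (w₀.val : GL (Fin 3) (LocalRing L v)) = cmLocalForm L 3 v)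
  [MeasurableSpace ↥t.N] (μ : Measure ↥t.N)
  (τ : Representation ℂ ↥t.P ℂ) (θ : Gqs L v → ℂ)

/-! ## §1 `Λ_1(f_w) = μ(N₀)` -/

section WeylEntry

variable (f_w : Representation.SmoothInd t.P τ) (heig_w : ∀ b ∈ I, Representation.smoothIndRep t.P τ b f_w = θ b • f_w)
  (hw1 : f_w.toFun 1 = 0) (hwg : f_w.toFun w₀ = 1) (hθ : ∀ n : ↥t.N, (n : Gqs L v) ∈ I → θ n = 1)

omit [MeasurableSpace ↥t.N] in
include hw heA hϖ hg₁ hK0 hK1 hI ht hw₀ heig_w hw1 hwg hθ in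
/-- **`f_w(w₀ n) = 𝟙_{N₀}(n)`** for `n ∈ N(L⁺_v)`, `N₀ = N ∩ I`: on `N₀`, `f_w(w₀n) = θ(n) f_w(w₀) = 1`; off `N₀` (`|z|_w > 1`, ★ FILE 2 §1) `w₀ n = p κ` with `p ∈ P`, `κ ∈ I` (★ FILE 2 §2) and
`f_w(p κ) = τ(p) θ(κ) f_w(1) = 0`. [cite: Casselman1980, §3] [cite: Keys1984, §7] -/
theorem toFun_weyl_mul_eq_indicator (n : ↥t.N) :
    f_w.toFun (w₀ * (n : Gqs L v)) = ({m : ↥t.N | (m : Gqs L v) ∈ I} : Set ↥t.N).indicator (fun _ => (1 : ℂ)) n := by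
  by_cases hn : (n : Gqs L v) ∈ I
  · rw [Set.indicator_of_mem (show n ∈ {m : ↥t.N | (m : Gqs L v) ∈ I} from hn),
      toFun_weyl_mul_of_mem L v I t w₀ τ θ f_w heig_w hn, hθ n hn, hwg, one_mul]
  · rw [Set.indicator_of_notMem (show n ∉ {m : ↥t.N | (m : Gqs L v) ∈ I} from hn)]
    obtain ⟨x, z, hux, hrel⟩ := exists_coe_eA_eq_upper L v w hw eA heA t ht n.2
    have hz : 1 < Valued.v z := by
      by_contra hz
      exact hn ((mem_iff_v_le_one L v w hw eA hϖ g₁ hg₁ K0 K1 I hK0 hK1 hI hux hrel).2 (not_lt.1 hz))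
    obtain ⟨p, hp, κ, hκ, hfac, -, -⟩ := exists_eq_mul_of_one_lt_v L v w hw eA heA hϖ g₁ hg₁ K0 K1 I hK0 hK1 hI t ht w₀ hw₀ hux hrel hz
    rw [toFun_weyl_mul_of_eq_mul L v I t w₀ τ θ f_w heig_w hp hκ hfac, hw1, mul_zero]

include hw heA hϖ hg₁ hK0 hK1 hI ht hw₀ heig_w hw1 hwg hθ in
/-- **`Λ_1(f_w) = ∫_N f_w(w₀ n) dμ(n) = μ(N₀)`** (`N₀ = N ∩ I` measurable) — the `(1, w)` entry of the Casselman pair is the CONSTANT `vol(N₀)` of `PAPER-Z3` §1.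
[cite: Casselman1980, §3] [cite: Casselman1995, §6.4] [cite: Keys1984, §7] -/
theorem integral_toFun_weyl_mul_eq (hS : MeasurableSet ({m : ↥t.N | (m : Gqs L v) ∈ I} : Set ↥t.N)) :
    ∫ n : ↥t.N, f_w.toFun (w₀ * (n : Gqs L v)) ∂μ = (μ.real ({m : ↥t.N | (m : Gqs L v) ∈ I} : Set ↥t.N) : ℂ) := by
  have hfun : (fun n : ↥t.N => f_w.toFun (w₀ * (n : Gqs L v))) = ({m : ↥t.N | (m : Gqs L v) ∈ I} : Set ↥t.N).indicator (fun _ => (1 : ℂ)) :=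
    funext (toFun_weyl_mul_eq_indicator L v w hw eA heA hϖ g₁ hg₁ K0 K1 I hK0 hK1 hI t ht w₀ hw₀ τ θ f_w heig_w hw1 hwg hθ)
  rw [hfun, integral_indicator_const (1 : ℂ) hS, Complex.real_smul, mul_one]

include hw heA hϖ hg₁ hK0 hK1 hI ht hw₀ heig_w hw1 hwg hθ in
/-- **`n ↦ f_w(w₀ n)` is integrable** as soon as `μ(N₀) < ∞` (an indicator). [cite: Casselman1995, §6.4] -/
theorem integrable_toFun_weyl_mul (hS : MeasurableSet ({m : ↥t.N | (m : Gqs L v) ∈ I} : Set ↥t.N)) (hfin : μ ({m : ↥t.N | (m : Gqs L v) ∈ I} : Set ↥t.N) ≠ ⊤) :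
    Integrable (fun n : ↥t.N => f_w.toFun (w₀ * (n : Gqs L v))) μ := by
  have hfun : (fun n : ↥t.N => f_w.toFun (w₀ * (n : Gqs L v))) = ({m : ↥t.N | (m : Gqs L v) ∈ I} : Set ↥t.N).indicator (fun _ => (1 : ℂ)) :=
    funext (toFun_weyl_mul_eq_indicator L v w hw eA heA hϖ g₁ hg₁ K0 K1 I hK0 hK1 hI t ht w₀ hw₀ τ θ f_w heig_w hw1 hwg hθ)
  rw [hfun, integrable_indicator_iff hS]
  exact integrableOn_const hfin

end WeylEntry

/-! ## §2 `Λ_{w₀}(f₁) = μ{n : w₀ n w₀ ∈ I}` -/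

section OneEntry

variable (f₁ : Representation.SmoothInd t.P τ) (heig₁ : ∀ b ∈ I, Representation.smoothIndRep t.P τ b f₁ = θ b • f₁)
  (h11 : f₁.toFun 1 = 1) (h1g : f₁.toFun w₀ = 0) (hθ : ∀ n : ↥t.N, w₀ * (n : Gqs L v) * w₀ ∈ I → θ (w₀ * (n : Gqs L v) * w₀) = 1)

omit [MeasurableSpace ↥t.N] in
include hw heA hϖ hg₁ hK0 hK1 hI ht hw₀ heig₁ h11 h1g hθ in
/-- **`f₁(w₀ n w₀) = 𝟙[w₀ n w₀ ∈ I]`** for `n ∈ N(L⁺_v)`: on `{w₀nw₀ ∈ I} = {|z|_w < 1}` (★ FILE 2 §4), `f₁(w₀nw₀) = θ·f₁(1) = 1`; off it (`|z|_w ≥ 1`) `w₀ n w₀ = p w₀ n₂` with `p ∈ P`, `n₂ ∈ I`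
(★ FILE 2 §3) and `f₁(p w₀ n₂) = τ(p) θ(n₂) f₁(w₀) = 0`. [cite: Casselman1980, §3] [cite: Keys1984, §7] -/
theorem toFun_conj_eq_indicator (n : ↥t.N) :
    f₁.toFun (w₀ * (n : Gqs L v) * w₀) = ({m : ↥t.N | w₀ * (m : Gqs L v) * w₀ ∈ I} : Set ↥t.N).indicator (fun _ => (1 : ℂ)) n := by
  by_cases hn : w₀ * (n : Gqs L v) * w₀ ∈ I
  · rw [Set.indicator_of_mem (show n ∈ {m : ↥t.N | w₀ * (m : Gqs L v) * w₀ ∈ I} from hn),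
      toFun_conj_of_mem L v I t w₀ τ θ f₁ heig₁ hn, hθ n hn, h11, one_mul]
  · rw [Set.indicator_of_notMem (show n ∉ {m : ↥t.N | w₀ * (m : Gqs L v) * w₀ ∈ I} from hn)]
    obtain ⟨x, z, hux, hrel⟩ := exists_coe_eA_eq_upper L v w hw eA heA t ht n.2
    have hz : 1 ≤ Valued.v z := by
      by_contra hz
      exact hn ((conj_mem_iff_v_lt_one L v w hw eA heA hϖ g₁ hg₁ K0 K1 I hK0 hK1 hI w₀ hw₀ hux hrel).2 (not_le.1 hz))
    obtain ⟨p, hp, n₂, hn₂, hfac, -, -⟩ := exists_conj_eq_mul_of_one_le_v L v w hw eA heA hϖ g₁ hg₁ K0 K1 I hK0 hK1 hI t ht w₀ hw₀ hux hrel hz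
    rw [toFun_conj_of_eq_mul L v I t w₀ τ θ f₁ heig₁ hp hn₂ hfac, h1g, mul_zero]

include hw heA hϖ hg₁ hK0 hK1 hI ht hw₀ heig₁ h11 h1g hθ in
/-- **`Λ_{w₀}(f₁) = ∫_N f₁(w₀ n w₀) dμ(n) = μ{n : w₀ n w₀ ∈ I}`** — the `(w, 1)` entry of the Casselman pair is the CONSTANT `vol N(𝔭)` of `PAPER-Z3` §1 (`{w₀nw₀ ∈ I} = {|z|_w < 1}`).
[cite: Casselman1980, §3] [cite: Casselman1995, §6.4] [cite: Keys1984, §7] -/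
theorem integral_toFun_conj_eq (hS : MeasurableSet ({m : ↥t.N | w₀ * (m : Gqs L v) * w₀ ∈ I} : Set ↥t.N)) :
    ∫ n : ↥t.N, f₁.toFun (w₀ * (n : Gqs L v) * w₀) ∂μ = (μ.real ({m : ↥t.N | w₀ * (m : Gqs L v) * w₀ ∈ I} : Set ↥t.N) : ℂ) := by
  have hfun : (fun n : ↥t.N => f₁.toFun (w₀ * (n : Gqs L v) * w₀)) = ({m : ↥t.N | w₀ * (m : Gqs L v) * w₀ ∈ I} : Set ↥t.N).indicator (fun _ => (1 : ℂ)) :=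
    funext (toFun_conj_eq_indicator L v w hw eA heA hϖ g₁ hg₁ K0 K1 I hK0 hK1 hI t ht w₀ hw₀ τ θ f₁ heig₁ h11 h1g hθ)
  rw [hfun, integral_indicator_const (1 : ℂ) hS, Complex.real_smul, mul_one]

include hw heA hϖ hg₁ hK0 hK1 hI ht hw₀ heig₁ h11 h1g hθ in
/-- **`n ↦ f₁(w₀ n w₀)` is integrable** as soon as `μ{n : w₀nw₀ ∈ I} < ∞` (an indicator). [cite: Casselman1995, §6.4] -/
theorem integrable_toFun_conj (hS : MeasurableSet ({m : ↥t.N | w₀ * (m : Gqs L v) * w₀ ∈ I} : Set ↥t.N))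
    (hfin : μ ({m : ↥t.N | w₀ * (m : Gqs L v) * w₀ ∈ I} : Set ↥t.N) ≠ ⊤) :
    Integrable (fun n : ↥t.N => f₁.toFun (w₀ * (n : Gqs L v) * w₀)) μ := by
  have hfun : (fun n : ↥t.N => f₁.toFun (w₀ * (n : Gqs L v) * w₀)) = ({m : ↥t.N | w₀ * (m : Gqs L v) * w₀ ∈ I} : Set ↥t.N).indicator (fun _ => (1 : ℂ)) :=
    funext (toFun_conj_eq_indicator L v w hw eA heA hϖ g₁ hg₁ K0 K1 I hK0 hK1 hI t ht w₀ hw₀ τ θ f₁ heig₁ h11 h1g hθ)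
  rw [hfun, integrable_indicator_iff hS]
  exact integrableOn_const hfin

end OneEntry

end Summit.HodgeConjecture.HodgeConjecture.Cruxes.H413.K2E3BranchBCasselmanPairConstants

end
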